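import Mathlib
import Literature.Combinatorics.Additive.TripleProductProperty
import Literature.Computability.AlgebraicComplexity.GroupTheoreticMatMul

/-!
# The residual (maximality) test for STPP families (census rule U8)

Support file for route `MatrixMultiplication/GroupTheoreticSTPP` (target `CThesis`, stmt-MatrixMultiplication-0593),
cell `mm-stpp` (D-0046), CENSUS-PLAN §3 (U8) / §7 S8: statements and proofs designed by the planner seat
mm-stpp-plan (HOME/mm-stpp-plan/ResidualTestSketch.lean), landed here in the three conventions of the tree
(`SimultaneousTPP` in a group, its `to_additive` twin `AddSimultaneousTPP`, and the census predicate `IsSTPP`)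
together with a **decidable Finset form** usable as a kernel pruning rule.

Fix an STPP family `(A i, B i, C i)_{i : ι}` (Cohn–Kleinberg–Szegedy–Umans 2005, Def. 5.1) and one index `t`
with `a ∈ A t`, `b ∈ B t`, `c ∈ C t`.  Clause (ii) of Def. 5.1 read on the index patterns `(t, j, k)`,
`(i, t, k)`, `(i, j, t)` (not all indices equal to `t`) gives three *residual* conditions on the quotients of
the triple `t`:

* `a⁻¹ c ∉ W j k := (A j)⁻¹ (B j) (B k)⁻¹ (C k)`   (`simultaneousTPP_residual_AC`),
* `a⁻¹ b ∉ X i k := (A i)⁻¹ (C i) (C k)⁻¹ (B k)`   (`simultaneousTPP_residual_AB`),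
* `b⁻¹ c ∉ Y i j := (B j)⁻¹ (A j) (A i)⁻¹ (C i)`   (`simultaneousTPP_residual_BC`),

while `a⁻¹ c = (a⁻¹ b)(b⁻¹ c)`.  Hence the **maximality test** `not_all_nonempty_of_residual`: if every
product `r₂ r₃` of an `X`-residual and a `Y`-residual element lies in `⋃ W`, then `A t, B t, C t` are not all
non-empty.  The special case `j = k` of the first condition is the covering-isolation rule U7
(`STPPCensusRules.covering_isolation`).  Census convention (`IsSTPP`, word `(s′−s)+(t′−t)+(u′−u) = 0`):
`a − b ∉ (C j − B j) + (A k − C k)`, `b − c ∉ (B i − A i) + (A k − C k)`, `c − a ∉ (B i − A i) + (C j − B j)`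
(`isSTPP_residual_AB/BC/CA`, `not_all_nonempty_of_isSTPP_residual`).

**Kernel pruning rule** (`not_isSTPP_cons_of_residual_test`): for an EXISTING family `(A i, B i, C i)_{i < k}`
in a finite abelian group let `W, X, Y ⊆ H` be the unions of the three sumsets over all index pairs; if
`−(r₁ + r₂) ∈ Y` for all `r₁ ∉ W`, `r₂ ∉ X` — a decidable condition on explicit data — then NO triple of
non-empty sets (of any shape) can be prepended to the family.  The planner's application: the CKSU Prop. 5.2
pair in `Cyc_n³` is maximal for every `n ≥ 3` (kernel: `Prop52Maximal.prop52_pair_maximal`).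

WHAT THIS IS NOT: a test for non-extendability of a given family only; it certifies no `ω` bound.

## References
* H. Cohn, R. Kleinberg, B. Szegedy, C. Umans, *Group-theoretic algorithms for matrix multiplication*,
  FOCS 2005, Def. 5.1.
-/

-- single-conjunct summit: the mandated namespace repeats `MatrixMultiplication`.
set_option linter.dupNamespace false

namespace Summit.MatrixMultiplication.MatrixMultiplication.Theorems

namespace STPPResidualTest

open Finset Literature.Combinatorics.Additive Literature.Computability.AlgebraicComplexity

/-! ### CKSU convention (`SimultaneousTPP` / `AddSimultaneousTPP`, any group) -/

section Group

variable {G : Type*} [Group G] {ι : Type*} {A B C : ι → Finset G}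

/-- Pattern `(t, j, k)` of CKSU Def. 5.1 (ii): for `a ∈ A t`, `c ∈ C t` the quotient `a⁻¹ c` avoids
`(A j)⁻¹ (B j) (B k)⁻¹ (C k)` unless `j = k = t`. [cite: CohnKleinbergSzegedyUmans2005, Def. 5.1] -/
@[to_additive addSimultaneousTPP_residual_AC /-- Pattern `(t, j, k)` of CKSU Def. 5.1 (ii), additive
notation: for `a ∈ A t`, `c ∈ C t`, `-a + c` avoids `-(A j) + (B j) - (B k) + (C k)` unless `j = k = t`.
(Reference: CohnKleinbergSzegedyUmans2005, Def. 5.1.) -/]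
theorem simultaneousTPP_residual_AC (h : SimultaneousTPP A B C) {t j k : ι} (hjk : ¬ (j = t ∧ k = t))
    {a : G} (ha : a ∈ A t) {c : G} (hc : c ∈ C t)
    {a' : G} (ha' : a' ∈ A j) {b₁ : G} (hb₁ : b₁ ∈ B j) {b' : G} (hb' : b' ∈ B k) {c₁ : G}
    (hc₁ : c₁ ∈ C k) : a⁻¹ * c ≠ a'⁻¹ * b₁ * b'⁻¹ * c₁ := by
  intro he
  apply hjk
  have key : a * a'⁻¹ * b₁ * b'⁻¹ * c₁ * c⁻¹ = 1 := by
    have h1 : a * (a⁻¹ * c) * c⁻¹ = 1 := by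
      rw [← mul_assoc, mul_inv_cancel, one_mul, mul_inv_cancel]
    rw [he] at h1
    simpa only [mul_assoc] using h1
  obtain ⟨h1, h2⟩ := h.2 t j k a ha a' ha' b₁ hb₁ b' hb' c₁ hc₁ c hc key
  exact ⟨h1.symm, (h1.trans h2).symm⟩

/-- Pattern `(i, t, k)` of CKSU Def. 5.1 (ii): for `a ∈ A t`, `b ∈ B t` the quotient `a⁻¹ b` avoids
`(A i)⁻¹ (C i) (C k)⁻¹ (B k)` unless `i = k = t`. [cite: CohnKleinbergSzegedyUmans2005, Def. 5.1] -/
@[to_additive addSimultaneousTPP_residual_AB /-- Pattern `(i, t, k)` of CKSU Def. 5.1 (ii), additive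
notation: for `a ∈ A t`, `b ∈ B t`, `-a + b` avoids `-(A i) + (C i) - (C k) + (B k)` unless `i = k = t`.
(Reference: CohnKleinbergSzegedyUmans2005, Def. 5.1.) -/]
theorem simultaneousTPP_residual_AB (h : SimultaneousTPP A B C) {t i k : ι} (hik : ¬ (i = t ∧ k = t))
    {a : G} (ha : a ∈ A t) {b : G} (hb : b ∈ B t)
    {aᵢ : G} (haᵢ : aᵢ ∈ A i) {cᵢ : G} (hcᵢ : cᵢ ∈ C i) {b' : G} (hb' : b' ∈ B k) {c₁ : G}
    (hc₁ : c₁ ∈ C k) : a⁻¹ * b ≠ aᵢ⁻¹ * cᵢ * c₁⁻¹ * b' := by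
  intro he
  apply hik
  have key : aᵢ * a⁻¹ * b * b'⁻¹ * c₁ * cᵢ⁻¹ = 1 := by
    have h1 : aᵢ * (aᵢ⁻¹ * cᵢ * c₁⁻¹ * b') * b'⁻¹ * c₁ * cᵢ⁻¹ = 1 := by simp [mul_assoc]
    rw [← he] at h1
    simpa only [mul_assoc] using h1
  obtain ⟨h1, h2⟩ := h.2 i t k aᵢ haᵢ a ha b hb b' hb' c₁ hc₁ cᵢ hcᵢ key
  exact ⟨h1, h2.symm⟩

/-- Pattern `(i, j, t)` of CKSU Def. 5.1 (ii): for `b ∈ B t`, `c ∈ C t` the quotient `b⁻¹ c` avoids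
`(B j)⁻¹ (A j) (A i)⁻¹ (C i)` unless `i = j = t`. [cite: CohnKleinbergSzegedyUmans2005, Def. 5.1] -/
@[to_additive addSimultaneousTPP_residual_BC /-- Pattern `(i, j, t)` of CKSU Def. 5.1 (ii), additive
notation: for `b ∈ B t`, `c ∈ C t`, `-b + c` avoids `-(B j) + (A j) - (A i) + (C i)` unless `i = j = t`.
(Reference: CohnKleinbergSzegedyUmans2005, Def. 5.1.) -/]
theorem simultaneousTPP_residual_BC (h : SimultaneousTPP A B C) {t i j : ι} (hij : ¬ (i = t ∧ j = t))
    {b : G} (hb : b ∈ B t) {c : G} (hc : c ∈ C t)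
    {aᵢ : G} (haᵢ : aᵢ ∈ A i) {cᵢ : G} (hcᵢ : cᵢ ∈ C i) {a' : G} (ha' : a' ∈ A j) {b₁ : G}
    (hb₁ : b₁ ∈ B j) : b⁻¹ * c ≠ b₁⁻¹ * a' * aᵢ⁻¹ * cᵢ := by
  intro he
  apply hij
  have key : aᵢ * a'⁻¹ * b₁ * b⁻¹ * c * cᵢ⁻¹ = 1 := by
    have h1 : aᵢ * a'⁻¹ * b₁ * (b₁⁻¹ * a' * aᵢ⁻¹ * cᵢ) * cᵢ⁻¹ = 1 := by simp [mul_assoc]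
    rw [← he] at h1
    simpa only [mul_assoc] using h1
  obtain ⟨h1, h2⟩ := h.2 i j t aᵢ haᵢ a' ha' b₁ hb₁ b hb c hc cᵢ hcᵢ key
  exact ⟨h1.trans h2, h2⟩

/-- **Residual (maximality) test** (planner rule U8).  If every product `r₂ r₃` of an element `r₂` avoiding
all `(A i)⁻¹ (C i) (C k)⁻¹ (B k)` and an element `r₃` avoiding all `(B j)⁻¹ (A j) (A i)⁻¹ (C i)` (index pairs
other than `(t, t)`) lies in some `(A j)⁻¹ (B j) (B k)⁻¹ (C k)` (again `(j, k) ≠ (t, t)`), then the triple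
`t` has an empty member.  Engines: with `R₁ = G ∖ ⋃ W`, `R₂ = G ∖ ⋃ X`, `R₃ = G ∖ ⋃ Y` computed from the
OTHER triples, `R₁ ∩ R₂·R₃ = ∅` certifies that no triple of three non-empty sets can be added.
[cite: CohnKleinbergSzegedyUmans2005, Def. 5.1] -/
@[to_additive not_all_nonempty_of_addResidual /-- **Residual (maximality) test**, additive notation
(planner rule U8): if every sum `r₂ + r₃` of an element `r₂` avoiding all `-(A i) + (C i) - (C k) + (B k)`
and an element `r₃` avoiding all `-(B j) + (A j) - (A i) + (C i)` (index pairs other than `(t, t)`) lies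
in some `-(A j) + (B j) - (B k) + (C k)` with `(j, k) ≠ (t, t)`, then the triple `t` has an empty member.
(Reference: CohnKleinbergSzegedyUmans2005, Def. 5.1.) -/]
theorem not_all_nonempty_of_residual (h : SimultaneousTPP A B C) (t : ι)
    (hcov : ∀ r₂ r₃ : G,
      (∀ i k, ¬ (i = t ∧ k = t) → ∀ aᵢ ∈ A i, ∀ cᵢ ∈ C i, ∀ b' ∈ B k, ∀ c₁ ∈ C k,
          r₂ ≠ aᵢ⁻¹ * cᵢ * c₁⁻¹ * b') →
      (∀ i j, ¬ (i = t ∧ j = t) → ∀ aᵢ ∈ A i, ∀ cᵢ ∈ C i, ∀ a' ∈ A j, ∀ b₁ ∈ B j,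
          r₃ ≠ b₁⁻¹ * a' * aᵢ⁻¹ * cᵢ) →
      ∃ j k, ¬ (j = t ∧ k = t) ∧ ∃ a' ∈ A j, ∃ b₁ ∈ B j, ∃ b' ∈ B k, ∃ c₁ ∈ C k,
          r₂ * r₃ = a'⁻¹ * b₁ * b'⁻¹ * c₁) :
    ¬ ((A t).Nonempty ∧ (B t).Nonempty ∧ (C t).Nonempty) := by
  rintro ⟨⟨a, ha⟩, ⟨b, hb⟩, ⟨c, hc⟩⟩
  have hX : ∀ i k, ¬ (i = t ∧ k = t) → ∀ aᵢ ∈ A i, ∀ cᵢ ∈ C i, ∀ b' ∈ B k, ∀ c₁ ∈ C k,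
      a⁻¹ * b ≠ aᵢ⁻¹ * cᵢ * c₁⁻¹ * b' :=
    fun i k hik aᵢ haᵢ cᵢ hcᵢ b' hb' c₁ hc₁ => simultaneousTPP_residual_AB h hik ha hb haᵢ hcᵢ hb' hc₁
  have hY : ∀ i j, ¬ (i = t ∧ j = t) → ∀ aᵢ ∈ A i, ∀ cᵢ ∈ C i, ∀ a' ∈ A j, ∀ b₁ ∈ B j,
      b⁻¹ * c ≠ b₁⁻¹ * a' * aᵢ⁻¹ * cᵢ :=
    fun i j hij aᵢ haᵢ cᵢ hcᵢ a' ha' b₁ hb₁ => simultaneousTPP_residual_BC h hij hb hc haᵢ hcᵢ ha' hb₁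
  obtain ⟨j, k, hjk, a', ha', b₁, hb₁, b', hb', c₁, hc₁, he⟩ := hcov (a⁻¹ * b) (b⁻¹ * c) hX hY
  have he' : a⁻¹ * c = a'⁻¹ * b₁ * b'⁻¹ * c₁ := by
    rw [← he, mul_assoc, mul_inv_cancel_left]
  exact simultaneousTPP_residual_AC h hjk ha hc ha' hb₁ hb' hc₁ he'

end Group

/-! ### Census convention (`IsSTPP`: word `(s′ − s) + (t′ − t) + (u′ − u) = 0`) -/

section Census

variable {H : Type*} [AddCommGroup H] {N : ℕ} {A B C : Fin N → Finset H}

/-- Census pattern `(t₀, j, k)`: for `a ∈ A t₀`, `b ∈ B t₀` the difference `a − b` avoids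
`(C j − B j) + (A k − C k)` unless `j = k = t₀`. [cite: CohnKleinbergSzegedyUmans2005, Def. 5.1] -/
theorem isSTPP_residual_AB (h : IsSTPP A B C) {t₀ j k : Fin N} (hjk : ¬ (j = t₀ ∧ k = t₀))
    {a : H} (ha : a ∈ A t₀) {b : H} (hb : b ∈ B t₀)
    {t' : H} (ht' : t' ∈ B j) {u : H} (hu : u ∈ C j) {u' : H} (hu' : u' ∈ C k) {s : H}
    (hs : s ∈ A k) : a - b ≠ (u - t') + (s - u') := by
  intro he
  apply hjk
  have key : (a - s) + (t' - b) + (u' - u) = 0 := by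
    have : (a - b) - ((u - t') + (s - u')) = 0 := by rw [he]; abel
    rw [← this]; abel
  obtain ⟨h1, h2, -⟩ := h t₀ j k s hs a ha b hb t' ht' u hu u' hu' key
  exact ⟨h1.symm, (h1.trans h2).symm⟩

/-- Census pattern `(i, t₀, k)`: for `b ∈ B t₀`, `c ∈ C t₀` the difference `b − c` avoids
`(B i − A i) + (A k − C k)` unless `i = k = t₀`. [cite: CohnKleinbergSzegedyUmans2005, Def. 5.1] -/
theorem isSTPP_residual_BC (h : IsSTPP A B C) {t₀ i k : Fin N} (hik : ¬ (i = t₀ ∧ k = t₀))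
    {b : H} (hb : b ∈ B t₀) {c : H} (hc : c ∈ C t₀)
    {s' : H} (hs' : s' ∈ A i) {t : H} (ht : t ∈ B i) {s : H} (hs : s ∈ A k) {u' : H}
    (hu' : u' ∈ C k) : b - c ≠ (t - s') + (s - u') := by
  intro he
  apply hik
  have key : (s' - s) + (b - t) + (u' - c) = 0 := by
    have : (b - c) - ((t - s') + (s - u')) = 0 := by rw [he]; abel
    rw [← this]; abel
  obtain ⟨h1, h2, -⟩ := h i t₀ k s hs s' hs' t ht b hb c hc u' hu' key
  exact ⟨h1, h2.symm⟩

/-- Census pattern `(i, j, t₀)`: for `c ∈ C t₀`, `a ∈ A t₀` the difference `c − a` avoids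
`(B i − A i) + (C j − B j)` unless `i = j = t₀`. [cite: CohnKleinbergSzegedyUmans2005, Def. 5.1] -/
theorem isSTPP_residual_CA (h : IsSTPP A B C) {t₀ i j : Fin N} (hij : ¬ (i = t₀ ∧ j = t₀))
    {c : H} (hc : c ∈ C t₀) {a : H} (ha : a ∈ A t₀)
    {s' : H} (hs' : s' ∈ A i) {t : H} (ht : t ∈ B i) {t' : H} (ht' : t' ∈ B j) {u : H}
    (hu : u ∈ C j) : c - a ≠ (t - s') + (u - t') := by
  intro he
  apply hij
  have key : (s' - a) + (t' - t) + (c - u) = 0 := by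
    have : (c - a) - ((t - s') + (u - t')) = 0 := by rw [he]; abel
    rw [← this]; abel
  obtain ⟨h1, h2, -⟩ := h i j t₀ a ha s' hs' t ht t' ht' u hu c hc key
  exact ⟨h1.trans h2, h2⟩

/-- **Residual (maximality) test, census convention** (planner rule U8).  With `R₁ = H ∖ ⋃ W`,
`R₂ = H ∖ ⋃ X`, `R₃ = H ∖ ⋃ Y` (`W j k = (C j − B j) + (A k − C k)`, `X i k = (B i − A i) + (A k − C k)`,
`Y i j = (B i − A i) + (C j − B j)`, unions over index pairs other than `(t₀, t₀)`): if `−(r₁ + r₂) ∉ R₃`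
for all `r₁ ∈ R₁`, `r₂ ∈ R₂`, then the triple `t₀` has an empty member.
[cite: CohnKleinbergSzegedyUmans2005, Def. 5.1] -/
theorem not_all_nonempty_of_isSTPP_residual (h : IsSTPP A B C) (t₀ : Fin N)
    (hcov : ∀ r₁ r₂ : H,
      (∀ j k, ¬ (j = t₀ ∧ k = t₀) → ∀ t' ∈ B j, ∀ u ∈ C j, ∀ u' ∈ C k, ∀ s ∈ A k,
          r₁ ≠ (u - t') + (s - u')) →
      (∀ i k, ¬ (i = t₀ ∧ k = t₀) → ∀ s' ∈ A i, ∀ t ∈ B i, ∀ s ∈ A k, ∀ u' ∈ C k,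
          r₂ ≠ (t - s') + (s - u')) →
      ∃ i j, ¬ (i = t₀ ∧ j = t₀) ∧ ∃ s' ∈ A i, ∃ t ∈ B i, ∃ t' ∈ B j, ∃ u ∈ C j,
          -(r₁ + r₂) = (t - s') + (u - t')) :
    ¬ ((A t₀).Nonempty ∧ (B t₀).Nonempty ∧ (C t₀).Nonempty) := by
  rintro ⟨⟨a, ha⟩, ⟨b, hb⟩, ⟨c, hc⟩⟩
  obtain ⟨i, j, hij, s', hs', t, ht, t', ht', u, hu, he⟩ := hcov (a - b) (b - c)
    (fun j k hjk t' ht' u hu u' hu' s hs => isSTPP_residual_AB h hjk ha hb ht' hu hu' hs)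
    (fun i k hik s' hs' t ht s hs u' hu' => isSTPP_residual_BC h hik hb hc hs' ht hs hu')
  have he' : c - a = (t - s') + (u - t') := by rw [← he]; abel
  exact isSTPP_residual_CA h hij hc ha hs' ht ht' hu he'

end Census

/-! ### Decidable form: a kernel certificate of maximality for an explicit family -/

section Decidable

open scoped Pointwise

variable {H : Type*} [AddCommGroup H] [DecidableEq H] {k : ℕ} {A B C : Fin k → Finset H}

/-- **Kernel pruning rule (maximality certificate).**  Let `(A i, B i, C i)_{i < k}` be finite sets in an
abelian group and let `W = ⋃_{j,k} (C j − B j) + (A k − C k)`, `X = ⋃_{i,k} (B i − A i) + (A k − C k)`,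
`Y = ⋃_{i,j} (B i − A i) + (C j − B j)` (unions over ALL index pairs of the existing family, as `Finset`s).
If every `r₁ ∉ W`, `r₂ ∉ X` has `−(r₁ + r₂) ∈ Y` — on explicit data in a finite host a `decide`-able
condition once `r₁, r₂` range over a `Fintype` — then no triple `(A₀, B₀, C₀)` of non-empty sets, of any
shape, can be prepended: `(A₀ :: A, B₀ :: B, C₀ :: C)` is never an STPP family.  (The residual test at the
new index `0`; all index pairs of old indices are pairs `≠ (0, 0)`.)
[cite: CohnKleinbergSzegedyUmans2005, Def. 5.1] -/
theorem not_isSTPP_cons_of_residual_test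
    (htest : ∀ r₁ r₂ : H,
      r₁ ∉ (univ : Finset (Fin k × Fin k)).biUnion (fun jk => (C jk.1 - B jk.1) + (A jk.2 - C jk.2)) →
      r₂ ∉ (univ : Finset (Fin k × Fin k)).biUnion (fun ik => (B ik.1 - A ik.1) + (A ik.2 - C ik.2)) →
      -(r₁ + r₂) ∈ (univ : Finset (Fin k × Fin k)).biUnion (fun ij => (B ij.1 - A ij.1) + (C ij.2 - B ij.2)))
    {A₀ B₀ C₀ : Finset H} (hA₀ : A₀.Nonempty) (hB₀ : B₀.Nonempty) (hC₀ : C₀.Nonempty) :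
    ¬ IsSTPP (Matrix.vecCons A₀ A) (Matrix.vecCons B₀ B) (Matrix.vecCons C₀ C) := by
  intro hS
  refine not_all_nonempty_of_isSTPP_residual hS 0 (fun r₁ r₂ hr₁ hr₂ => ?_) ⟨hA₀, hB₀, hC₀⟩
  have h1 : r₁ ∉ (univ : Finset (Fin k × Fin k)).biUnion
      (fun jk => (C jk.1 - B jk.1) + (A jk.2 - C jk.2)) := by
    intro hmem
    obtain ⟨⟨j, k'⟩, -, hjk⟩ := mem_biUnion.1 hmem
    obtain ⟨x, hx, y, hy, hxy⟩ := mem_add.1 hjk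
    obtain ⟨u, hu, t', ht', rfl⟩ := mem_sub.1 hx
    obtain ⟨s, hs, u', hu', rfl⟩ := mem_sub.1 hy
    exact hr₁ j.succ k'.succ (by simp [Fin.succ_ne_zero]) t' (by simpa using ht') u (by simpa using hu)
      u' (by simpa using hu') s (by simpa using hs) hxy.symm
  have h2 : r₂ ∉ (univ : Finset (Fin k × Fin k)).biUnion
      (fun ik => (B ik.1 - A ik.1) + (A ik.2 - C ik.2)) := by
    intro hmem
    obtain ⟨⟨i, k'⟩, -, hik⟩ := mem_biUnion.1 hmem
    obtain ⟨x, hx, y, hy, hxy⟩ := mem_add.1 hik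
    obtain ⟨t, ht, s', hs', rfl⟩ := mem_sub.1 hx
    obtain ⟨s, hs, u', hu', rfl⟩ := mem_sub.1 hy
    exact hr₂ i.succ k'.succ (by simp [Fin.succ_ne_zero]) s' (by simpa using hs') t (by simpa using ht)
      s (by simpa using hs) u' (by simpa using hu') hxy.symm
  obtain ⟨⟨i, j⟩, -, hij⟩ := mem_biUnion.1 (htest r₁ r₂ h1 h2)
  obtain ⟨x, hx, y, hy, hxy⟩ := mem_add.1 hij
  obtain ⟨t, ht, s', hs', rfl⟩ := mem_sub.1 hx
  obtain ⟨u, hu, t', ht', rfl⟩ := mem_sub.1 hy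
  exact ⟨i.succ, j.succ, by simp [Fin.succ_ne_zero], s', by simpa using hs', t, by simpa using ht,
    t', by simpa using ht', u, by simpa using hu, hxy.symm⟩

/-- The same certificate with the residual elements ranging over a `Fintype` host, so that the hypothesis
is literally a closed decidable proposition (`decide` / `Finset.decidableDforallFinset`).
[cite: CohnKleinbergSzegedyUmans2005, Def. 5.1] -/
theorem not_isSTPP_cons_of_residual_test_univ [Fintype H]
    (htest : ∀ r₁ ∈ (univ : Finset H) \
        (univ : Finset (Fin k × Fin k)).biUnion (fun jk => (C jk.1 - B jk.1) + (A jk.2 - C jk.2)),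
      ∀ r₂ ∈ (univ : Finset H) \
        (univ : Finset (Fin k × Fin k)).biUnion (fun ik => (B ik.1 - A ik.1) + (A ik.2 - C ik.2)),
      -(r₁ + r₂) ∈ (univ : Finset (Fin k × Fin k)).biUnion (fun ij => (B ij.1 - A ij.1) + (C ij.2 - B ij.2)))
    {A₀ B₀ C₀ : Finset H} (hA₀ : A₀.Nonempty) (hB₀ : B₀.Nonempty) (hC₀ : C₀.Nonempty) :
    ¬ IsSTPP (Matrix.vecCons A₀ A) (Matrix.vecCons B₀ B) (Matrix.vecCons C₀ C) :=
  not_isSTPP_cons_of_residual_test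
    (fun r₁ r₂ h1 h2 => htest r₁ (mem_sdiff.2 ⟨mem_univ _, h1⟩) r₂ (mem_sdiff.2 ⟨mem_univ _, h2⟩))
    hA₀ hB₀ hC₀

end Decidable

end STPPResidualTest

end Summit.MatrixMultiplication.MatrixMultiplication.Theorems
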